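/-
COR-CM (cells pub-hodgecm / pub-hodgecm2, stage 2 of the Hodge ladder) — TRANSPOSITION item (vi), S-LANE CARRIERS-PLAN step S7, RE-CUT #3 («PLUGGED»): the
landed ω × Hecke UNION display `Transposition/Item6SupplyPinnedAssemblyAlongHoldsRestOneOmegaHecke.lean` (pin-3, p321050) with FOUR of its displayed
inputs NO LONGER POSITED but taken BY NAME from the tree: `iso := Model.isoOf` (own-htheta, `Item6IsotropicAt.lean` p321037 — «𝕍 ⊗_𝔸 ℚ_p is isotropic»,
[Liu2021] §4.2 l. 2055, DEFINED; never read at rank 3), `P := Def45.PolDR ι₁ _ R` (hcmisog-isog-2, `Liu2021/Def45Polarisation.lean` p318471 — Def. 4.5 (2)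
bullet 3 `λ_μ` REAL as `IsPolarisationClass`; bullet 4 `r_μ` the DISPLAYED token `R` with `hR`), `hObj := Def45.nonempty_cmDatum_polarised_of_casselman' … h21 R hR`
(b25 + hcmisog-isog-2, `Def45PolarisationNormalised.lean` p319607 over `Prop46NonemptyOfCasselman{,Units,Uniformizers}.lean` p314768 / p315281 / p317180 —
[Liu2021] Prop. 4.6 (1) «𝒜(μ) is nonempty» with bullets 1–3 PROVED modulo the ONE cite `h21 = shimura1998_thm21_4_casselman` ([Shimura1998] Thm. 21.4 =
Casselman's theorem, [Shi71] Thm. 6) and the token `hR`), and `s / hs / hsc := OmegaMuSplitting.sMu / hsMu / hscMu` (mc-theta-3's plug `Item6OmegaMuSplitting.lean`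
p321268, filed by own-htheta: the [GR91, Prop. 3.1.1] compatible continuous splitting family ATTACHED TO the Hecke character `χ_μ := toHeckeCharacter (μ(Φ, ι₁))`,
i.e. `chiSplittingLine … χ_μ …` over the χ_μ-normalised doubled Weil representation of `Liu2021/Def411WeilCarriersDoubling.lean` p319194 — CARRIERS-PLAN §5
(C′) GUARD honoured: no `splittingOf` / bare choice).  EFFECT ON THE DISPLAY of p321050 §2 (12 named + hM): `iso`, `P`, `s`, `hs`, `hsc`, `hObj` GONE;
NEW displayed: the cite `h21` and the de Rham token `R` with its inhabitation `hR` ⇒ 9 NAMED {h, hA; C, R, hR; T; hLiu; h21; hirr} + hM.  What is STILL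
POSITED: `C : Sec42Data (honestP5Of h …) (isoOf …)` (CARRIERS-PLAN S5, pin-1's `sec42DataOf`, by application later), `T : … → (C …).HeckeTranslates`
(S6 = TEAM hComp U7 → B → A, by application later), and the de Rham token `R` (Def. 4.5 (2) bullet 4 `r_μ : M_μ ⊗_ℚ E ≅ H_1^dR(A_μ/E)`; no algebraic de
Rham HOMOLOGY with its `M_μ ⊗ E`-module structure in the tree — DISPLAYED, not hidden).  Seat prover-pub-hodgecm-own-htheta-g5-0 (own-htheta gen 5, S2-CRUX
owner and S2 CO-OWNER per CARRIERS-PLAN §4 «owners of S2 = pin-3 successor + own-htheta»; rule-(1) NAMING with first refusal to pin-3 g3, who worded «re-cut #3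
NOT started by this generation (wall)» in CRUNCH PIN-3 ed. 8).  Theorems only: TWO theorems, each ONE APPLICATION of pin-3's p321050 §1 / §2; no definition,
no instance, no named fact, no `variable`; nothing landed is edited or restated (NEW path, FILE-ONCE).
RED-TEAM CLASS SENTENCES (TGTBT D22.3 item 1 / D23.3 / D24.3 items 1–3; the classification is the red team's, these sentences only LOCATE it):
(W1) at `P := PolDR … R`: the object type `Def45.CMDatum … (Carriers.ofPolDR μ (PolDR ι₁ _ R))` = Liu's `𝒜(μ)` objects EXCEPT that bullet 4 `r_μ` is the
token `R`; hence `hLiu` / the `hObj` supplier read «[Liu2021] Thm. 4.18 / Prop. 4.6 (1) + l. 1984 (“the existence of `r_μ` is obvious”)» — the «+ l. 1982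
([Shi71] Thm. 5: λ_μ)» residual of the earlier displays is GONE (bullet 3 is REAL and SUPPLIED); `R`/`hR` are DISPLAYED binders, no `R := PUnit` inside.
(W3) at `s := sMu`: `hLiu` asks [Liu2021] Thm. 4.18 for the oscillator ALONG `chiSplittingLine χ_μ` (χ_μ = `toHeckeCharacter (muOfInvType ι₁ Φ)`,
`OmegaMuSplitting.chiMu_eq`); that this IS the printed `ω(μ, ε, χ)` of App. D Step 2 (l. 5219: `ω(ε) ∘ ι_μ`) is [HKS96 §1 (1.14)–(1.15)] + the UNIQUENESS of
the χ-normalised splitting `s_D` [GR91 §3.1 p. 455 L1–3 / Remark p. 457] — the uniqueness is mc-theta-3's (α) packet ((α-0) `UnitaryGroupDoubledSiegelSplitCharacters`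
p321399 ✔, (α-1) `GelbartRogawski1991/DoubledWeilRepresentationUniqueness` p321792, (α-2) `Liu2021/Def411WeilCarriersDoublingUnique`), NOT asserted by any
binder of this file and NOT yet consumed by name here: the class is «Thm. 4.18 for the χ_μ-oscillator; = as printed under (α)», NOT «as printed» unqualified.
(Hecke/U7) every `hLiu`/`hirr` slot reads the CONSTRUCTED action `(T F ι₁ V Φ h6).rhoΩOne …` (S6b p317191) of the POSITED translates `T`, no `rhoΩ`
binder; that action IS the printed Hecke action of l. 2219 once `T := heckeTranslatesFamilyOf hU7 …` is plugged (S6/U7, [MilISV] Thm. 13.6 `hU7`) — so the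
full class of `hLiu` here is «Thm. 4.18 for the χ_μ-oscillator at the Hecke action of the posited `T`; = as printed under (α) AND (U7)» (cite-2 §49).
FRAMING: HC_CM is NOT proved; S2 = B01-S is NOT inhabited by this file; `C`, `T`, `R` are POSITED; `h`/`hA`/`hLiu`/`h21`/`hirr`/`hR`/`hM` are HYPOTHESES.
-/
import Summits.HodgeConjecture.CorCM.B01.Transposition.Item6SupplyPinnedAssemblyAlongHoldsRestOneOmegaHecke
import Summits.HodgeConjecture.CorCM.B01.Transposition.Item6OmegaMuSplitting
import Summits.HodgeConjecture.CorCM.B01.Transposition.Item6IsotropicAt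
import Literature.NumberTheory.Automorphic.Liu2021.Def45PolarisationNormalised
import HarnessLib

set_option autoImplicit false

/-!
# B01-S and the (β)-free END display at the PLUGGED rest: `iso`, `P`-λ-half, `hObj`, `s/hs/hsc` taken from the tree (S7, re-cut #3)

Instantiation of pin-3's `…_restOne_omega_hecke` (§1 :68) / `…_restOne_omega_hecke_meeting_rec` (§2 :128), both BY ONE APPLICATION:
`iso := Model.isoOf`; `P := fun F _ ι₁ V Φ => Def45.PolDR ι₁ (isConjugateSymplectic_muOfInvType ι₁ Φ) (R F ι₁ V Φ)`;
`s := OmegaMuSplitting.sMu`, `hs := OmegaMuSplitting.hsMu`, `hsc := OmegaMuSplitting.hscMu`;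
`hObj := fun F _ h6 Φ ι₁ hι V => Def45.nonempty_cmDatum_polarised_of_casselman' ι₁ (isConjugateSymplectic_muOfInvType ι₁ Φ) (hasWeight_one_muOfInvType ι₁ Φ) h21 (R F ι₁ V Φ) (hR F ι₁ V Φ)`.
All displayed types agree after β-reduction — no `rw`, no `▸`, no auxiliary `def`, default heartbeats.  Later plugs, by application on THIS theorem:
`C := Model.sec42DataOf h _ Model.isoOf` (S5, pin-1) and `T := heckeTranslatesFamilyOf hU7 h … Model.isoOf` (S6, TEAM hComp U7 → B → A; +1 cite `hU7`);
`hirr ↦ (hD1 : LemD1AsPrinted …)` by name; `hA ↦ albanese_baseChange_isLimit_fan_jacobian_of_albanese_baseChange hAbc` (p312823).  HC_CM is NOT proved.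

References: Y. Liu, arXiv:2102.11518 = Camb. J. Math. 9 (2021) (`FJcycle.tex` md5 6db49a74122d): Def. 4.5 (2) l. 1944–1958, Prop. 4.6 (1) l. 1969 + proof
l. 1975–1984, Def. 4.11–4.12 l. 2083–2108, Def. 4.16–Rem. 4.17 l. 2219–2227, Thm. 4.18 l. 2232–2245, §4.2 l. 2053–2074, App. D §D.1 Steps 1–3 l. 5215–5223.
G. Shimura, *Abelian Varieties with Complex Multiplication and Modular Functions* (1998), Thm. 21.4, §6.2 Thm. 4 (3).  S. Gelbart, J. Rogawski, Invent. Math. 105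
(1991) §3.1 Prop. 3.1.1.  M. Harris, S. Kudla, W. Sweet, J. AMS 9 (1996) §1.  J. S. Milne, *Introduction to Shimura varieties* (2005) Thm. 13.6.
-/

noncomputable section

open scoped TensorProduct InnerProductSpace Kronecker

namespace Summit.HodgeConjecture.CorCM.Model

open CategoryTheory CategoryTheory.Limits AlgebraicGeometry NumberField
open Literature.AlgebraicGeometry.Motives
open Literature.AlgebraicGeometry.HodgeTheory
open Literature.AlgebraicGeometry.ShimuraVarieties
open Literature.AlgebraicGeometry.ShimuraVarieties.UnitaryCanonicalModel
open Literature.NumberTheory.ComplexMultiplication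
open Literature.NumberTheory.Automorphic
open Literature.NumberTheory.Automorphic.IdeleClassGroup
open Literature.NumberTheory.Automorphic.PicardCM
open Literature.NumberTheory.Automorphic.Liu2021
open Literature.NumberTheory.Automorphic.Liu2021.AppendixC
open Literature.NumberTheory.Automorphic.Liu2021.AppendixC.RestOne
open Literature.NumberTheory.Automorphic.Liu2021.Def411WeilCarriers (JW TW isSymm_TW isUnit_det_TW JW_eq)
open Literature.NumberTheory.GelbartRogawski1991 Literature.NumberTheory.GelbartRogawski1991.UnitaryDualPair
open Literature.NumberTheory.Weil1964 Literature.RepresentationTheory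
open Summit.HodgeConjecture.CorCM.Transposition

/-! ## §1  B01-S at the plugged rest (by application of the ω × Hecke union) -/

/-- **B01-S from [Liu2021, Thm. 4.18] at the PLUGGED one-object rest** (`U = picardCMUniverse hHD hI h₁ h₃`): pin-3's
`faceSupply_of_thm418AsPrinted_along_conj_holds_restOne_omega_hecke` (p321050 §1) at `iso := Model.isoOf`, `P := Def45.PolDR ι₁ _ (R …)`,
`s/hs/hsc := OmegaMuSplitting.sMu/hsMu/hscMu`, `hObj := Def45.nonempty_cmDatum_polarised_of_casselman' … h21 (R …) (hR …)` — ONE APPLICATION.  Displayed: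
the cites `h` ([Deligne1979] 2.1.2/2.2.5), `hA` ([Liu2021] §2.1 + [FGA]), `h21` ([Shimura1998] Thm. 21.4); the POSITED carriers `C` (§4.2 / App. C system
over the honest P5 datum and the DEFINED `isoOf`), `T` (Hecke translates, [MilISV] Def. 12.10 (a) shape), the de Rham TOKEN `R` with `hR` (Def. 4.5 (2)
bullet 4 `r_μ`); the cite `hLiu` (Thm. 4.18 l. 2232–2245 for the χ_μ-oscillator at the constructed Hecke action — class (W3) «= as printed under (α)», see
the module header; (W1) residual «+ l. 1984» only) and the reading `hirr` (Def. 4.11 «irreducible», [Liu2021] Lem. D.1 (1)).  NO `iso`, `P`, `s`, `hs`,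
`hsc`, `hObj`, `hChi`, `hsm`, `rhoΩ`, `hμ`, `i`, `hdim`, `hdet45` binder.  HC_CM is NOT proved; none of the hypotheses is inhabited here.
[cite: Liu2021, Thm. 4.18 (FJcycle.tex l. 2232–2245), Prop. 4.6 (1) (l. 1969, proof l. 1975–1984), Def. 4.5 (2) (l. 1944–1958), §4.2 l. 2053–2074]
[cite: Shimura1998, §21.4 Thm. 21.4] [cite: GelbartRogawski1991, §3.1 Prop. 3.1.1] [cite: Deligne1979ShimuraVarieties, §2.1.2 and 2.2.5] -/
theorem faceSupply_of_thm418AsPrinted_along_conj_holds_restOne_plugged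
    (hHD : exists_isReal_hodgeModel) (hI : hodgePQ_independent_of_hodgeModel)
    (h₁ : BallQuotientUniformised) (h₃ : CMAbelianVarietyRealised)
    (h : exists_recordSystem) (hA : albanese_baseChange_isLimit_fan_jacobian)
    (C : ∀ (F : CMField) (ι₁ : F →+* ℂ) (V : HermSpace3 F ι₁) (Φ : CMType F), Sec42Data (honestP5Of h F ι₁ V Φ) (isoOf F ι₁ V Φ))
    (R : ∀ (F : CMField) [IsGalois ℚ F] (ι₁ : F →+* ℂ) (_ : HermSpace3 F ι₁) (Φ : CMType F) (A : AbelianVariety F),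
      (muAlgValueField F (muOfInvType ι₁ Φ) →+* A.endAlgebra) → Type)
    (hR : ∀ (F : CMField) [IsGalois ℚ F] (ι₁ : F →+* ℂ) (V : HermSpace3 F ι₁) (Φ : CMType F) (A : AbelianVariety F)
      (i : muAlgValueField F (muOfInvType ι₁ Φ) →+* A.endAlgebra), Nonempty (R F ι₁ V Φ A i))
    (T : ∀ (F : CMField) (ι₁ : F →+* ℂ) (V : HermSpace3 F ι₁) (Φ : CMType F), 6 ≤ Module.finrank ℚ F →
      (C F ι₁ V Φ).HeckeTranslates)
    (hLiu : ∀ (F : CMField) [IsGalois ℚ F] (h6 : 6 ≤ Module.finrank ℚ F) (Φ : CMType F) (ι₁ : F →+* ℂ), ι₁ ∈ Φ.1 →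
      ∀ V : HermSpace3 F ι₁, Thm418AsPrintedC (C F ι₁ V Φ)
        (restOne (C F ι₁ V Φ) (AlgHom.id ℚ F) ι₁ (isConjugateSymplectic_muOfInvType ι₁ Φ) (hasWeight_one_muOfInvType ι₁ Φ) (Def45.Carriers.ofPolDR (muOfInvType ι₁ Φ) (Def45.PolDR ι₁ (isConjugateSymplectic_muOfInvType ι₁ Φ) (R F ι₁ V Φ)))
            (Def411WeilCarriers.Eps ↥(maximalRealSubfield F) (imagUnitSq F)) (Def411WeilCarriers.epsOf ↥(maximalRealSubfield F) (imagUnitSq F) F (imagUnit F)) (Def411WeilCarriers.Chi ↥(maximalRealSubfield F) F (IsCMField.complexConj F))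
            (Def411WeilCarriers.omega ↥(maximalRealSubfield F) F (IsCMField.complexConj F) 3 finProdFinEquiv (Matrix.diagonal V.diagEntries) (complexConj_imagUnit F) (imagUnit_ne_zero F) (imagUnit_mul_self F) (realDiagonal_isSymm F V.diagEntries V.complexConj_diagEntries) (isUnit_det_realDiagonal F V.diagEntries V.complexConj_diagEntries V.diagEntries_ne_zero) (realDiagonal_map F V.diagEntries V.complexConj_diagEntries).symm (OmegaMuSplitting.hsMu F ι₁ V Φ))
            (Def411WeilCarriers.rho ↥(maximalRealSubfield F) F (IsCMField.complexConj F) 3 finProdFinEquiv (Matrix.diagonal V.diagEntries) (complexConj_imagUnit F) (imagUnit_ne_zero F) (imagUnit_mul_self F) (realDiagonal_isSymm F V.diagEntries V.complexConj_diagEntries) (isUnit_det_realDiagonal F V.diagEntries V.complexConj_diagEntries V.diagEntries_ne_zero) (realDiagonal_map F V.diagEntries V.complexConj_diagEntries).symm (OmegaMuSplitting.hsMu F ι₁ V Φ) V.adelicFinDiag.toMulEquiv.toMonoidHom) ((T F ι₁ V Φ h6).rhoΩOne (AlgHom.id ℚ F) ι₁ (isConjugateSymplectic_muOfInvType ι₁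 Φ) (hasWeight_one_muOfInvType ι₁ Φ) (Def45.Carriers.ofPolDR (muOfInvType ι₁ Φ) (Def45.PolDR ι₁ (isConjugateSymplectic_muOfInvType ι₁ Φ) (R F ι₁ V Φ))))))
    (h21 : shimura1998_thm21_4_casselman)
    (hirr : ∀ (F : CMField) [IsGalois ℚ F] (h6 : 6 ≤ Module.finrank ℚ F) (Φ : CMType F) (ι₁ : F →+* ℂ), ι₁ ∈ Φ.1 →
      ∀ (V : HermSpace3 F ι₁)
        (i : (toThm418Data (C F ι₁ V Φ)
          (restOne (C F ι₁ V Φ) (AlgHom.id ℚ F) ι₁ (isConjugateSymplectic_muOfInvType ι₁ Φ) (hasWeight_one_muOfInvType ι₁ Φ) (Def45.Carriers.ofPolDR (muOfInvType ι₁ Φ) (Def45.PolDR ι₁ (isConjugateSymplectic_muOfInvType ι₁ Φ) (R F ι₁ V Φ)))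
            (Def411WeilCarriers.Eps ↥(maximalRealSubfield F) (imagUnitSq F)) (Def411WeilCarriers.epsOf ↥(maximalRealSubfield F) (imagUnitSq F) F (imagUnit F)) (Def411WeilCarriers.Chi ↥(maximalRealSubfield F) F (IsCMField.complexConj F))
            (Def411WeilCarriers.omega ↥(maximalRealSubfield F) F (IsCMField.complexConj F) 3 finProdFinEquiv (Matrix.diagonal V.diagEntries) (complexConj_imagUnit F) (imagUnit_ne_zero F) (imagUnit_mul_self F) (realDiagonal_isSymm F V.diagEntries V.complexConj_diagEntries) (isUnit_det_realDiagonal F V.diagEntries V.complexConj_diagEntries V.diagEntries_ne_zero) (realDiagonal_map F V.diagEntries V.complexConj_diagEntries).symm (OmegaMuSplitting.hsMu F ι₁ V Φ))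
            (Def411WeilCarriers.rho ↥(maximalRealSubfield F) F (IsCMField.complexConj F) 3 finProdFinEquiv (Matrix.diagonal V.diagEntries) (complexConj_imagUnit F) (imagUnit_ne_zero F) (imagUnit_mul_self F) (realDiagonal_isSymm F V.diagEntries V.complexConj_diagEntries) (isUnit_det_realDiagonal F V.diagEntries V.complexConj_diagEntries V.diagEntries_ne_zero) (realDiagonal_map F V.diagEntries V.complexConj_diagEntries).symm (OmegaMuSplitting.hsMu F ι₁ V Φ) V.adelicFinDiag.toMulEquiv.toMonoidHom) ((T F ι₁ V Φ h6).rhoΩOne (AlgHom.id ℚ F) ι₁ (isConjugateSymplectic_muOfInvType ι₁ Φ) (hasWeight_one_muOfInvType ι₁ Φ) (Def45.Carriers.ofPolDR (muOfInvType ι₁ Φ) (Def45.PolDR ι₁ (isConjugateSymplectic_muOfInvType ι₁ Φ) (R F ι₁ V Φ)))))).AdmIndex),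
        (Def411WeilCarriers.rho ↥(maximalRealSubfield F) F (IsCMField.complexConj F) 3 finProdFinEquiv (Matrix.diagonal V.diagEntries) (complexConj_imagUnit F) (imagUnit_ne_zero F) (imagUnit_mul_self F) (realDiagonal_isSymm F V.diagEntries V.complexConj_diagEntries) (isUnit_det_realDiagonal F V.diagEntries V.complexConj_diagEntries V.diagEntries_ne_zero) (realDiagonal_map F V.diagEntries V.complexConj_diagEntries).symm (OmegaMuSplitting.hsMu F ι₁ V Φ) V.adelicFinDiag.toMulEquiv.toMonoidHom i.1.1 i.1.2).IsIrreducible) :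
    (picardCMUniverse hHD hI h₁ h₃).FaceSupply :=
  faceSupply_of_thm418AsPrinted_along_conj_holds_restOne_omega_hecke hHD hI h₁ h₃ h hA isoOf C
    -- Def. 4.5 (2) bullets 3–4: bullet 3 REAL (`IsPolarisationClass`), bullet 4 the displayed token `R`
    (fun F _ ι₁ V Φ => Def45.PolDR ι₁ (isConjugateSymplectic_muOfInvType ι₁ Φ) (R F ι₁ V Φ))
    -- the splitting family ATTACHED TO χ_μ = μ(Φ, ι₁): mc-theta-3's plug
    OmegaMuSplitting.sMu OmegaMuSplitting.hsMu OmegaMuSplitting.hscMu T hLiu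
    -- Prop. 4.6 (1) «𝒜(μ) ≠ ∅» from Casselman's theorem `h21` and the de Rham token `hR` (b25 / hcmisog-isog-2)
    (fun F _ _ Φ ι₁ _ V => Def45.nonempty_cmDatum_polarised_of_casselman' ι₁ (isConjugateSymplectic_muOfInvType ι₁ Φ)
      (hasWeight_one_muOfInvType ι₁ Φ) h21 (R F ι₁ V Φ) (hR F ι₁ V Φ))
    hirr


/-! ## §2  THE (β)-FREE END DISPLAY, MEETING FORM, on the universe of record, at the plugged rest -/

section MeetingFormPlugged

open MeasureTheory
open Prior.Perl34File (Perl34.IsolationSetting)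
open Prior.Perl34File.Perl34

/-- **END DISPLAY, (β)-FREE MEETING FORM, on the universe OF RECORD, at the PLUGGED rest** (`let U := U_rec`): pin-3's
`hc_cm_of_thm418AsPrinted_along_conj_holds_restOne_omega_hecke_meeting_rec` (p321050 §2 :128) at the same four plugs — ONE APPLICATION.  Displayed
hypotheses = data {`C`, `R`, `T`} · cites {`h`, `hA`, `h21`} · readings {`hR`, `hLiu`, `hirr`} + the theta-side meeting binder `hM` (b01-x2's text VERBATIM at
`U_rec`) = 9 NAMED + hM.  HC_CM is NOT proved: no hypothesis is inhabited here.
[cite: Liu2021, Thm. 4.18 (FJcycle.tex l. 2232–2245), Prop. 4.6 (1) (l. 1969), Def. 4.5 (2) (l. 1944–1958)] [cite: Shimura1998, §21.4 Thm. 21.4]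
[cite: Deligne1979ShimuraVarieties, §2.1.2 and 2.2.5] -/
theorem hc_cm_of_thm418AsPrinted_along_conj_holds_restOne_plugged_meeting_rec
    (h : exists_recordSystem) (hA : albanese_baseChange_isLimit_fan_jacobian)
    (C : ∀ (F : CMField) (ι₁ : F →+* ℂ) (V : HermSpace3 F ι₁) (Φ : CMType F), Sec42Data (honestP5Of h F ι₁ V Φ) (isoOf F ι₁ V Φ))
    (R : ∀ (F : CMField) [IsGalois ℚ F] (ι₁ : F →+* ℂ) (_ : HermSpace3 F ι₁) (Φ : CMType F) (A : AbelianVariety F),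
      (muAlgValueField F (muOfInvType ι₁ Φ) →+* A.endAlgebra) → Type)
    (hR : ∀ (F : CMField) [IsGalois ℚ F] (ι₁ : F →+* ℂ) (V : HermSpace3 F ι₁) (Φ : CMType F) (A : AbelianVariety F)
      (i : muAlgValueField F (muOfInvType ι₁ Φ) →+* A.endAlgebra), Nonempty (R F ι₁ V Φ A i))
    (T : ∀ (F : CMField) (ι₁ : F →+* ℂ) (V : HermSpace3 F ι₁) (Φ : CMType F), 6 ≤ Module.finrank ℚ F →
      (C F ι₁ V Φ).HeckeTranslates)
    (hLiu : ∀ (F : CMField) [IsGalois ℚ F] (h6 : 6 ≤ Module.finrank ℚ F) (Φ : CMType F) (ι₁ : F →+* ℂ), ι₁ ∈ Φ.1 →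
      ∀ V : HermSpace3 F ι₁, Thm418AsPrintedC (C F ι₁ V Φ)
        (restOne (C F ι₁ V Φ) (AlgHom.id ℚ F) ι₁ (isConjugateSymplectic_muOfInvType ι₁ Φ) (hasWeight_one_muOfInvType ι₁ Φ) (Def45.Carriers.ofPolDR (muOfInvType ι₁ Φ) (Def45.PolDR ι₁ (isConjugateSymplectic_muOfInvType ι₁ Φ) (R F ι₁ V Φ)))
            (Def411WeilCarriers.Eps ↥(maximalRealSubfield F) (imagUnitSq F)) (Def411WeilCarriers.epsOf ↥(maximalRealSubfield F) (imagUnitSq F) F (imagUnit F)) (Def411WeilCarriers.Chi ↥(maximalRealSubfield F) F (IsCMField.complexConj F))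
            (Def411WeilCarriers.omega ↥(maximalRealSubfield F) F (IsCMField.complexConj F) 3 finProdFinEquiv (Matrix.diagonal V.diagEntries) (complexConj_imagUnit F) (imagUnit_ne_zero F) (imagUnit_mul_self F) (realDiagonal_isSymm F V.diagEntries V.complexConj_diagEntries) (isUnit_det_realDiagonal F V.diagEntries V.complexConj_diagEntries V.diagEntries_ne_zero) (realDiagonal_map F V.diagEntries V.complexConj_diagEntries).symm (OmegaMuSplitting.hsMu F ι₁ V Φ))
            (Def411WeilCarriers.rho ↥(maximalRealSubfield F) F (IsCMField.complexConj F) 3 finProdFinEquiv (Matrix.diagonal V.diagEntries) (complexConj_imagUnit F) (imagUnit_ne_zero F) (imagUnit_mul_self F) (realDiagonal_isSymm F V.diagEntries V.complexConj_diagEntries) (isUnit_det_realDiagonal F V.diagEntries V.complexConj_diagEntries V.diagEntries_ne_zero) (realDiagonal_map F V.diagEntries V.complexConj_diagEntries).symm (OmegaMuSplitting.hsMu F ι₁ V Φ) V.adelicFinDiag.toMulEquiv.toMonoidHom) ((T F ι₁ V Φ h6).rhoΩOne (AlgHom.id ℚ F) ι₁ (isConjugateSymplectic_muOfInvType ι₁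 Φ) (hasWeight_one_muOfInvType ι₁ Φ) (Def45.Carriers.ofPolDR (muOfInvType ι₁ Φ) (Def45.PolDR ι₁ (isConjugateSymplectic_muOfInvType ι₁ Φ) (R F ι₁ V Φ))))))
    (h21 : shimura1998_thm21_4_casselman)
    (hirr : ∀ (F : CMField) [IsGalois ℚ F] (h6 : 6 ≤ Module.finrank ℚ F) (Φ : CMType F) (ι₁ : F →+* ℂ), ι₁ ∈ Φ.1 →
      ∀ (V : HermSpace3 F ι₁)
        (i : (toThm418Data (C F ι₁ V Φ)
          (restOne (C F ι₁ V Φ) (AlgHom.id ℚ F) ι₁ (isConjugateSymplectic_muOfInvType ι₁ Φ) (hasWeight_one_muOfInvType ι₁ Φ) (Def45.Carriers.ofPolDR (muOfInvType ι₁ Φ) (Def45.PolDR ι₁ (isConjugateSymplectic_muOfInvType ι₁ Φ) (R F ι₁ V Φ)))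
            (Def411WeilCarriers.Eps ↥(maximalRealSubfield F) (imagUnitSq F)) (Def411WeilCarriers.epsOf ↥(maximalRealSubfield F) (imagUnitSq F) F (imagUnit F)) (Def411WeilCarriers.Chi ↥(maximalRealSubfield F) F (IsCMField.complexConj F))
            (Def411WeilCarriers.omega ↥(maximalRealSubfield F) F (IsCMField.complexConj F) 3 finProdFinEquiv (Matrix.diagonal V.diagEntries) (complexConj_imagUnit F) (imagUnit_ne_zero F) (imagUnit_mul_self F) (realDiagonal_isSymm F V.diagEntries V.complexConj_diagEntries) (isUnit_det_realDiagonal F V.diagEntries V.complexConj_diagEntries V.diagEntries_ne_zero) (realDiagonal_map F V.diagEntries V.complexConj_diagEntries).symm (OmegaMuSplitting.hsMu F ι₁ V Φ))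
            (Def411WeilCarriers.rho ↥(maximalRealSubfield F) F (IsCMField.complexConj F) 3 finProdFinEquiv (Matrix.diagonal V.diagEntries) (complexConj_imagUnit F) (imagUnit_ne_zero F) (imagUnit_mul_self F) (realDiagonal_isSymm F V.diagEntries V.complexConj_diagEntries) (isUnit_det_realDiagonal F V.diagEntries V.complexConj_diagEntries V.diagEntries_ne_zero) (realDiagonal_map F V.diagEntries V.complexConj_diagEntries).symm (OmegaMuSplitting.hsMu F ι₁ V Φ) V.adelicFinDiag.toMulEquiv.toMonoidHom) ((T F ι₁ V Φ h6).rhoΩOne (AlgHom.id ℚ F) ι₁ (isConjugateSymplectic_muOfInvType ι₁ Φ) (hasWeight_one_muOfInvType ι₁ Φ) (Def45.Carriers.ofPolDR (muOfInvType ι₁ Φ) (Def45.PolDR ι₁ (isConjugateSymplectic_muOfInvType ι₁ Φ) (R F ι₁ V Φ)))))).AdmIndex),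
        (Def411WeilCarriers.rho ↥(maximalRealSubfield F) F (IsCMField.complexConj F) 3 finProdFinEquiv (Matrix.diagonal V.diagEntries) (complexConj_imagUnit F) (imagUnit_ne_zero F) (imagUnit_mul_self F) (realDiagonal_isSymm F V.diagEntries V.complexConj_diagEntries) (isUnit_det_realDiagonal F V.diagEntries V.complexConj_diagEntries V.diagEntries_ne_zero) (realDiagonal_map F V.diagEntries V.complexConj_diagEntries).symm (OmegaMuSplitting.hsMu F ι₁ V Φ) V.adelicFinDiag.toMulEquiv.toMonoidHom i.1.1 i.1.2).IsIrreducible) :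
    let U := picardCMUniverse exists_isReal_hodgeModel_holds hodgePQ_independent_of_hodgeModel_holds
      BallQuotient.ballQuotientUniformised_holds cmAbelianVarietyRealised_holds
    let hU := ballQuotientUniformisedDatum_of BallQuotient.ballQuotientUniformised_holds
    (∀ (F : CMField), IsGalois ℚ F → 6 ≤ Module.finrank ℚ F → ∀ (f : Face F) (ι₁ : F →+* ℂ), f.Admissible ι₁ →
      ∀ V : HermSpace3 F ι₁,
      ∃ (H CG G SK SigIdx SigIdxG : Type) (_ : NormedAddCommGroup H) (_ : InnerProductSpace ℂ H) (_ : CompleteSpace H)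
        (_ : NormedAddCommGroup CG) (_ : NormedSpace ℂ CG) (_ : Group G) (_ : TopologicalSpace G) (_ : TopologicalSpace SK)
        (S : Perl34.IsolationSetting H (Lp ℂ 2 V.autMeasure) CG G SK SigIdx SigIdxG),
        (∀ (Γ : Level V) (ω₁ ω₂ : U.CohC (U.pms F ι₁ V Γ) 1),
          ω₁ ∈ U.Uiso Γ F (f.psi 0) ι₁ → ω₂ ∈ U.Uiso Γ F (f.psi 1) ι₁ →
            embOf exists_isReal_hodgeModel_holds hodgePQ_independent_of_hodgeModel_holds hU cmAbelianVarietyRealised_holds Γ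
                (U.cup2C (U.pms F ι₁ V Γ) 1 ω₁ ω₂) ≠ 0 →
              ∃ u ∈ S.t12.S12,
                ⟪embOf exists_isReal_hodgeModel_holds hodgePQ_independent_of_hodgeModel_holds hU cmAbelianVarietyRealised_holds Γ
                    (U.cup2C (U.pms F ι₁ V Γ) 1 ω₁ ω₂), u⟫_ℂ ≠ 0) ∧
        (∀ χ : S.t34.X, S.t34.allowed χ → ∀ (Φ : SK) (Γ₁ : Level V)
          (ω₁ ω₂ : U.CohC (U.pms F ι₁ V Γ₁) 1),
          ω₁ ∈ U.Uiso Γ₁ F (f.psi 0) ι₁ →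
          ω₂ ∈ U.Uiso Γ₁ F (f.psi 1) ι₁ →
            ⟪embOf exists_isReal_hodgeModel_holds hodgePQ_independent_of_hodgeModel_holds hU cmAbelianVarietyRealised_holds Γ₁
                (U.cup2C (U.pms F ι₁ V Γ₁) 1 ω₁ ω₂),
              S.t34.ϑ χ Φ⟫_ℂ ≠ 0 →
              ∃ (Γ : Level V) (ω : Fin 4 → U.CohC (U.pms F ι₁ V Γ) 1),
                (∀ i, ω i ∈ U.Uiso Γ F (f.psi i) ι₁) ∧
                  ⟪embOf exists_isReal_hodgeModel_holds hodgePQ_independent_of_hodgeModel_holds hU cmAbelianVarietyRealised_holds Γ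
                      (U.cup2C (U.pms F ι₁ V Γ) 1 (ω 2) (ω 3)),
                    embOf exists_isReal_hodgeModel_holds hodgePQ_independent_of_hodgeModel_holds hU cmAbelianVarietyRealised_holds Γ
                      (U.cup2C (U.pms F ι₁ V Γ) 1 (ω 0) (ω 1))⟫_ℂ
                    ≠ 0)) →
    HC_CM :=
  hc_cm_of_thm418AsPrinted_along_conj_holds_restOne_omega_hecke_meeting_rec h hA isoOf C
    (fun F _ ι₁ V Φ => Def45.PolDR ι₁ (isConjugateSymplectic_muOfInvType ι₁ Φ) (R F ι₁ V Φ))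
    OmegaMuSplitting.sMu OmegaMuSplitting.hsMu OmegaMuSplitting.hscMu T hLiu
    (fun F _ _ Φ ι₁ _ V => Def45.nonempty_cmDatum_polarised_of_casselman' ι₁ (isConjugateSymplectic_muOfInvType ι₁ Φ)
      (hasWeight_one_muOfInvType ι₁ Φ) h21 (R F ι₁ V Φ) (hR F ι₁ V Φ))
    hirr

end MeetingFormPlugged

end Summit.HodgeConjecture.CorCM.Model

end
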